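import Summits.MatrixMultiplication.MatrixMultiplication.Theorems.AbelianSTPPCensusE3KShape

/-!
# Rule E3KJ: the three-room energy rule with JOINT (room-capped) Kneser classes (cell mm-stpp, theory g14)

The E3K rule (`STPPThreeRoomEnergy.false_of_energy3k`, eng-2 g7) credits, for ONE heavy member `t` (`2V > M`) of an STPP family in a finite abelian
group, the floor `V − s_X` to `|X_t − X_t| − 1` differences and the pair floor to the `|Q| − 1 − n_A − n_B` further elements of the pair class
`Q = (A_t − B_t) − (A_t − B_t)`, with `|X_t − X_t|` and `|Q|` bounded below by Kneser's minima `knLB M x` and `knLB M (ab)` taken INDEPENDENTLY over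
all divisors `d` of `M` (the order of the period).  The minima are attained at large periods (`X_t` inside a coset of order `d ≥ x`, `Q` a single
coset), and those are exactly the configurations the member's own ROOMS forbid.  Two joint lemmas, both at set level:

* **J1 (`card_addStab_letterA_le` + letters B, C by rotation).**  `K = Stab(A_t − A_t)` is a subgroup inside `A_t − A_t`, so `K + (B_t − C_t)` is a direct
  sum (`|K|·|B_t||C_t|` elements: a coincidence is a TPP pattern of member `t`) inside the room `(B_t − C_t) + (A_t − A_t)`, which packs with the sets
  `B_u − C_u`, `u ≠ t` (`STPPPackingSumset.sum_card_mul_add_card_sumset_le` for the rotated family): `|K|·bc + Σ_{u≠t} b_u c_u ≤ M`.  Hence the period of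
  `A_t − A_t` has order `d ≤ (V + s_A)/(bc)`, and Kneser's bound may be minimised over those divisors only (`knLBc`).
* **J2 (`kneser_pairClass`, `pairClass_one_coset_room`) = eng-2's pencilled L1–L3 (HOME/mm-stpp-eng-2/e3k7/E3K-NOTE.md §5).**  `E = A_t − B_t`, `K = Stab(Q)` of order `d`,
  `E` meets `m` cosets of `K`: Kneser gives `|Q| ≥ (2m − 1)d`.  If `m = 1` then `C_t` injects into `G ⧸ K` (`(C_t − C_t) ∩ Q = {0}`), its image has a
  difference set of `≥ knLB (M/d) c` classes (Kneser in the quotient group), and over each class the room `E + (C_t − C_t)` (which packs with `A_u − B_u`,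
  `u ≠ t`) contains a translate of `E`: `ab · knLB (M/d) c + Σ_{u≠t} a_u b_u ≤ M`.  When this fails, `m ≥ 2` and `|Q| ≥ 3d` (`knLBJ`).

The kill schema `false_of_energy3kj` is `false_of_energy3k` with these weaker admissibility hypotheses on `(n_A, n_B, n_C, q)`.  The shape predicate
`E3kjAdm`, its soundness and the evaluations (kills of the quartet champions at 620 / 910 / 3 638 / 3 720; silent at 594 / 832 / 3 655) are the companion
file `AbelianSTPPCensusE3KJShape`; exact Python twin `HOME/mm-stpp-theory/quartetwall/e3kj.py` (reproduces eng-2's pencil value at 486: `q 54 → 78`).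
WHAT THIS IS NOT: no census number, no existence claim, no `ω` statement; a necessary condition refining E3K (every E3K kill is an E3KJ kill).
-/

set_option linter.dupNamespace false -- `MatrixMultiplication.MatrixMultiplication` (summit = problem, D-0017)
set_option autoImplicit false

namespace Summit.MatrixMultiplication.MatrixMultiplication.Theorems

namespace STPPThreeRoomEnergy

open Finset Literature.Computability.AlgebraicComplexity
open scoped Pointwise

variable {G : Type*} [AddCommGroup G] [DecidableEq G] [Fintype G] {N : ℕ} {A B C : Fin N → Finset G}

/-! ## Kneser for `S − S` with the stabiliser exposed -/

omit [Fintype G] in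
/-- The stabiliser of a non-empty `T` lies inside `T − t₀` for every `t₀ ∈ T`; in particular inside `T` when `0 ∈ T`. [bookkeeping] -/
theorem addStab_subset_of_zero_mem {T : Finset G} (hT : T.Nonempty) (h0 : (0 : G) ∈ T) : T.addStab ⊆ T := by
  intro k hk
  have hk' := (mem_addStab hT).1 hk
  have : k +ᵥ (0 : G) ∈ k +ᵥ T := vadd_mem_vadd_finset h0
  rw [hk', vadd_eq_add, add_zero] at this
  exact this

omit [Fintype G] in
/-- The stabiliser of a non-empty finset is closed under subtraction. [bookkeeping] -/
theorem sub_mem_addStab {T : Finset G} (hT : T.Nonempty) {k k' : G} (hk : k ∈ T.addStab) (hk' : k' ∈ T.addStab) :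
    k - k' ∈ T.addStab := by
  rw [← mem_coe, coe_addStab hT] at hk hk' ⊢
  exact AddSubgroup.sub_mem _ hk hk'

/-- **Kneser for `S − S`, stabiliser exposed**: with `K = Stab(S − S)` and `d = |K|`: `d ∣ |G|`, `0 < d`, and `2·d·⌈|S|/d⌉ ≤ |S − S| + d`.
[cite: Nathanson1996, Thm 4.3] -/
theorem kneser_sub_self_addStab (S : Finset G) (hS : S.Nonempty) :
    (S - S).addStab.card ∣ Fintype.card G ∧ 0 < (S - S).addStab.card ∧
      2 * ((S - S).addStab.card * ((S.card + (S - S).addStab.card - 1) / (S - S).addStab.card)) ≤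
        (S - S).card + (S - S).addStab.card := by
  classical
  have hT : (S - S).Nonempty := hS.sub hS
  set K : Finset G := (S - S).addStab with hK
  have hKne : K.Nonempty := hT.addStab
  have h0K : (0 : G) ∈ K := hT.zero_mem_addStab
  refine ⟨hT.card_addStab_dvd_card_univ, hKne.card_pos, ?_⟩
  have hsub : S - S = S + -S := sub_eq_add_neg S S
  have hkn := Literature.Combinatorics.Additive.add_kneser (s := S) (t := -S)
  rw [← hsub, ← hK] at hkn
  have hdX : K.card ∣ (S + K).card := by
    have := card_addStab_dvd_card_add_addStab S (S - S); rwa [← hK] at this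
  have hdY : K.card ∣ (-S + K).card := by
    have := card_addStab_dvd_card_add_addStab (-S) (S - S); rwa [← hK] at this
  have hXsub : S.card ≤ (S + K).card := card_le_card (subset_add_left S h0K)
  have hYsub : S.card ≤ (-S + K).card := by
    have := card_le_card (subset_add_left (-S) h0K); rwa [card_neg] at this
  have h1 := STPPRoomKneser.mul_ceilDiv_le_of_dvd hKne.card_pos hdX hXsub
  have h2 := STPPRoomKneser.mul_ceilDiv_le_of_dvd hKne.card_pos hdY hYsub
  omega

/-! ## J1: the stabiliser of a letter's difference set is capped by the room -/

/-- **J1 (room cap on the period of `A_l − A_l`).**  For an STPP family with non-empty sets and `K = Stab(A_l − A_l)`: the sum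
`K + (B_l − C_l)` is direct (`|K|·|B_l|·|C_l|` elements — `K` is a subgroup inside `A_l − A_l`, so a coincidence is a TPP pattern of
member `l`) and lies in the room `(B_l − C_l) + (A_l − A_l)` of the rotated family, which packs with the sets `B_t − C_t`, `t ≠ l`
(`STPPPackingSumset.sum_card_mul_add_card_sumset_le`).  Hence `|K|·|B_l||C_l| + Σ_{t≠l} |B_t||C_t| ≤ |G|`. [original] -/
theorem card_addStab_letterA_le (h : IsSTPP A B C) (hA : ∀ u, (A u).Nonempty) (l : Fin N) :
    (A l - A l).addStab.card * ((B l).card * (C l).card) + ∑ t ∈ univ.erase l, (B t).card * (C t).card ≤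
      Fintype.card G := by
  classical
  have hT : (A l - A l).Nonempty := (hA l).sub (hA l)
  have h0T : (0 : G) ∈ A l - A l := by
    obtain ⟨s, hs⟩ := hA l
    exact mem_sub.2 ⟨s, hs, s, hs, sub_self s⟩
  set K := (A l - A l).addStab with hK
  have hKsub : K ⊆ A l - A l := addStab_subset_of_zero_mem hT h0T
  have hroom := STPPPackingSumset.sum_card_mul_add_card_sumset_le h.rotate hA l
  -- the direct sum K + (B_l − C_l) inside the room (B_l − C_l) + (A_l − A_l)
  have hinj : Set.InjOn (fun p : G × (G × G) => p.1 + (p.2.1 - p.2.2)) ↑(K ×ˢ ((B l) ×ˢ (C l))) := by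
    rintro ⟨k, t, u⟩ hp ⟨k', t', u'⟩ hp' he
    simp only [coe_product, Set.mem_prod, mem_coe] at hp hp'
    simp only at he
    have hkk : k - k' ∈ A l - A l := hKsub (sub_mem_addStab hT hp.1 hp'.1)
    obtain ⟨s, hs, s', hs', hss⟩ := mem_sub.1 hkk
    have he' : (s - s') + (t - t') + (u' - u) = 0 := by
      rw [hss]
      calc (k - k') + (t - t') + (u' - u) = (k + (t - u)) - (k' + (t' - u')) := by abel
        _ = 0 := by rw [he, sub_self]
    obtain ⟨-, -, hs2, ht2, hu2⟩ := h l l l s' hs' s hs t' hp'.2.1 t hp.2.1 u hp.2.2 u' hp'.2.2 he'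
    have hk : k = k' := sub_eq_zero.1 (by rw [← hss, hs2, sub_self])
    rw [hk, ht2, hu2]
  have himg : (K ×ˢ ((B l) ×ˢ (C l))).image (fun p : G × (G × G) => p.1 + (p.2.1 - p.2.2)) ⊆
      (B l - C l) + (A l - A l) := by
    intro x hx
    obtain ⟨⟨k, t, u⟩, hp, rfl⟩ := mem_image.1 hx
    simp only [mem_product] at hp
    show k + (t - u) ∈ B l - C l + (A l - A l)
    rw [show k + (t - u) = (t - u) + k from add_comm _ _]
    exact add_mem_add (sub_mem_sub hp.2.1 hp.2.2) (hKsub hp.1)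
  have hcard := card_le_card himg
  rw [card_image_of_injOn hinj, card_product, card_product] at hcard
  omega

/-- J1 for the letter `B` (rotate the family once). [original] -/
theorem card_addStab_letterB_le (h : IsSTPP A B C) (hB : ∀ u, (B u).Nonempty) (l : Fin N) :
    (B l - B l).addStab.card * ((C l).card * (A l).card) + ∑ t ∈ univ.erase l, (C t).card * (A t).card ≤
      Fintype.card G :=
  card_addStab_letterA_le h.rotate hB l

/-- J1 for the letter `C` (rotate twice). [original] -/
theorem card_addStab_letterC_le (h : IsSTPP A B C) (hC : ∀ u, (C u).Nonempty) (l : Fin N) :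
    (C l - C l).addStab.card * ((A l).card * (B l).card) + ∑ t ∈ univ.erase l, (A t).card * (B t).card ≤
      Fintype.card G :=
  card_addStab_letterA_le h.rotate.rotate hC l

/-! ## J2: the pair class `Q = (A_l − B_l) − (A_l − B_l)` — Kneser with the period exposed, and the one-coset case -/

omit [Fintype G] in
/-- The stabiliser of a non-empty finset is symmetric. [bookkeeping] -/
theorem neg_addStab_eq {T : Finset G} (hT : T.Nonempty) : -T.addStab = T.addStab := by
  have hneg : ∀ x ∈ T.addStab, -x ∈ T.addStab := fun x hx => by
    have := sub_mem_addStab hT hT.zero_mem_addStab hx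
    rwa [zero_sub] at this
  ext x
  refine ⟨fun hx => ?_, fun hx => mem_neg.2 ⟨-x, hneg x hx, neg_neg x⟩⟩
  obtain ⟨y, hy, rfl⟩ := mem_neg.1 hx
  exact hneg y hy

/-- **Kneser for the pair class with the period exposed**: `E = A_l − B_l`, `Q = E − E`, `K = Stab(Q)`: `2·|E + K| ≤ |Q| + |K|`,
`|K| ∣ |E + K|`, `|K| ∣ |G|`, `0 < |K|`. [cite: Nathanson1996, Thm 4.3] -/
theorem kneser_pairClass (E : Finset G) (hE : E.Nonempty) :
    2 * (E + (E - E).addStab).card ≤ (E - E).card + (E - E).addStab.card ∧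
      (E - E).addStab.card ∣ (E + (E - E).addStab).card ∧ (E - E).addStab.card ∣ Fintype.card G ∧
        0 < (E - E).addStab.card := by
  classical
  have hQ : (E - E).Nonempty := hE.sub hE
  set K : Finset G := (E - E).addStab with hK
  have hsub : E - E = E + -E := sub_eq_add_neg E E
  have hkn := Literature.Combinatorics.Additive.add_kneser (s := E) (t := -E)
  rw [← hsub, ← hK] at hkn
  have hKneg : -K = K := by rw [hK]; exact neg_addStab_eq hQ
  have hneg : (-E + K).card = (E + K).card := by
    conv_lhs => rw [← hKneg]
    rw [← neg_add, card_neg]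
  refine ⟨by omega, ?_, hQ.card_addStab_dvd_card_univ, hQ.addStab.card_pos⟩
  have := card_addStab_dvd_card_add_addStab E (E - E); rwa [← hK] at this

omit [Fintype G] in
/-- In an STPP family the pair class `Q = (A_l − B_l) − (A_l − B_l)` meets `C_l − C_l` only in `0`. [bookkeeping] -/
theorem eq_of_sub_mem_pairClass (h : IsSTPP A B C) (l : Fin N) {u u' : G} (hu : u ∈ C l) (hu' : u' ∈ C l)
    (hq : u - u' ∈ (A l - B l) - (A l - B l)) : u = u' := by
  obtain ⟨e, he, e', he', hee⟩ := mem_sub.1 hq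
  obtain ⟨s, hs, t, ht, rfl⟩ := mem_sub.1 he
  obtain ⟨s', hs', t', ht', rfl⟩ := mem_sub.1 he'
  -- (s - t) - (s' - t') = u - u'  ⇒  (s - s') + (t' - t) + (u' - u) = 0
  have he0 : (s - s') + (t' - t) + (u' - u) = 0 := by
    calc (s - s') + (t' - t) + (u' - u) = ((s - t) - (s' - t')) - (u - u') := by abel
      _ = 0 := by rw [hee, sub_self]
  obtain ⟨-, -, -, -, huu⟩ := h l l l s' hs' s hs t ht t' ht' u hu u' hu' he0
  exact huu

/-- **J2 (one-coset case of the pair class).**  `E = A_l − B_l`, `Q = E − E`, `K = Stab(Q)` of order `d`.  If `E` lies in ONE coset of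
`K` (`|E + K| = d`), then the room `E + (C_l − C_l)` (which packs with the sets `A_t − B_t`, `t ≠ l`) splits over the quotient `G ⧸ K`:
`C_l` injects into the quotient (`(C_l − C_l) ∩ Q = {0}`, `K ⊆ Q`), its image has a difference set of at least `knLB (|G|/d) |C_l|` classes
(Kneser in the quotient group, order `|G|/d`), and over each class the room contains a translate of `E`.  Hence
`|A_l||B_l| · knLB (|G|/d) |C_l| + Σ_{t≠l} |A_t||B_t| ≤ |G|`. [original] -/
theorem pairClass_one_coset_room (h : IsSTPP A B C) (hA : ∀ u, (A u).Nonempty) (hB : ∀ u, (B u).Nonempty)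
    (hC : ∀ u, (C u).Nonempty) (l : Fin N)
    (h1 : ((A l - B l) + ((A l - B l) - (A l - B l)).addStab).card = ((A l - B l) - (A l - B l)).addStab.card) :
    (A l).card * (B l).card * knLB (Fintype.card G / ((A l - B l) - (A l - B l)).addStab.card) (C l).card +
      ∑ t ∈ univ.erase l, (A t).card * (B t).card ≤ Fintype.card G := by
  classical
  set E := A l - B l with hEdef
  have hE : E.Nonempty := (hA l).sub (hB l)
  set Q := E - E with hQdef
  have hQ : Q.Nonempty := hE.sub hE
  set K := Q.addStab with hKdef
  have hKne : K.Nonempty := hQ.addStab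
  have h0K : (0 : G) ∈ K := hQ.zero_mem_addStab
  have h0Q : (0 : G) ∈ Q := by obtain ⟨e, he⟩ := hE; exact mem_sub.2 ⟨e, he, e, he, sub_self e⟩
  have hKQ : K ⊆ Q := addStab_subset_of_zero_mem hQ h0Q
  -- the subgroup behind K
  obtain ⟨H, hH⟩ : ∃ H : AddSubgroup G, (K : Set G) = H := ⟨_, coe_addStab hQ⟩
  have hmemH : ∀ x, x ∈ H ↔ x ∈ K := fun x => by rw [← SetLike.mem_coe, ← hH, mem_coe]
  -- E inside one coset: E + K = e₀ +ᵥ K, so e - e₀ ∈ K for e ∈ E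
  obtain ⟨e₀, he₀⟩ := hE
  have hEK : E + K = e₀ +ᵥ K := by
    symm
    apply eq_of_subset_of_card_le
    · intro x hx
      obtain ⟨k, hk, rfl⟩ := mem_vadd_finset.1 hx
      exact add_mem_add he₀ hk
    · rw [card_vadd_finset, h1]
  have hEcoset : ∀ e ∈ E, e - e₀ ∈ H := by
    intro e he
    have : e ∈ E + K := by simpa using add_mem_add he h0K
    rw [hEK] at this
    obtain ⟨k, hk, hke⟩ := mem_vadd_finset.1 this
    rw [hmemH]
    have : e - e₀ = k := by rw [← hke, vadd_eq_add]; abel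
    rw [this]; exact hk
  -- the quotient map and the image of C_l
  let π : G →+ G ⧸ H := QuotientAddGroup.mk' H
  have hπE : ∀ e ∈ E, π e = π e₀ := by
    intro e he
    rw [QuotientAddGroup.mk'_apply, QuotientAddGroup.mk'_apply, QuotientAddGroup.eq_iff_sub_mem]
    exact hEcoset e he
  set Cb := (C l).image π with hCb
  have hinjC : Set.InjOn π ↑(C l) := by
    intro u hu u' hu' huu
    have hmem : u - u' ∈ K := by
      rw [← hmemH]
      rw [QuotientAddGroup.mk'_apply, QuotientAddGroup.mk'_apply, QuotientAddGroup.eq_iff_sub_mem] at huu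
      exact huu
    exact eq_of_sub_mem_pairClass h l hu hu' (hKQ hmem)
  have hCbcard : Cb.card = (C l).card := card_image_of_injOn hinjC
  have hCbne : Cb.Nonempty := (hC l).image π
  -- Kneser in the quotient group
  have hcardQ : Fintype.card (G ⧸ H) = Fintype.card G / K.card := by
    have hL := AddSubgroup.card_eq_card_quotient_mul_card_addSubgroup H
    have hKc : Nat.card H = K.card := by
      rw [← SetLike.coe_sort_coe, ← hH, Nat.card_coe_set_eq, Set.ncard_coe_finset]
    rw [Nat.card_eq_fintype_card, Nat.card_eq_fintype_card, hKc] at hL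
    rw [hL, Nat.mul_div_cancel _ hKne.card_pos]
  have hkn : knLB (Fintype.card G / K.card) (C l).card ≤ (Cb - Cb).card := by
    obtain ⟨d', hd', hd'pos, hineq⟩ := two_mul_ceilDiv_le_card_sub_self Cb hCbne
    rw [hCbcard, hcardQ] at *
    have hMpos : 0 < Fintype.card G / K.card :=
      Nat.div_pos (Nat.le_of_dvd Fintype.card_pos hQ.card_addStab_dvd_card_univ) hKne.card_pos
    have := knLB_le (n := (C l).card) hMpos hd'pos hd'
    omega
  -- the room E + (C_l − C_l) and its fibres over the quotient
  have hroom := STPPPackingSumset.sum_card_mul_add_card_sumset_le h hC l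
  set S := E + (C l - C l) with hSdef
  have hfib : (Cb - Cb).card * E.card ≤ S.card := by
    -- S.card = Σ over its image classes of fibre sizes; restrict to the classes π e₀ + (Cb − Cb)
    have hdecomp := card_eq_sum_card_fiberwise (f := π) (s := S) (t := S.image π) (fun x hx => mem_image_of_mem π hx)
    -- each class y ∈ Cb − Cb gives the class π e₀ + y of S whose fibre contains a translate of E
    have hcl : ∀ y ∈ Cb - Cb, E.card ≤ (S.filter (fun x => π x = π e₀ + y)).card := by
      intro y hy
      obtain ⟨cu, hcu, cu', hcu', rfl⟩ := mem_sub.1 hy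
      obtain ⟨u, hu, rfl⟩ := mem_image.1 hcu
      obtain ⟨u', hu', rfl⟩ := mem_image.1 hcu'
      have hsub : E.image (· + (u - u')) ⊆ S.filter (fun x => π x = π e₀ + (π u - π u')) := by
        intro x hx
        obtain ⟨e, he, rfl⟩ := mem_image.1 hx
        rw [mem_filter]
        refine ⟨add_mem_add he (sub_mem_sub hu hu'), ?_⟩
        rw [map_add, map_sub, hπE e he]
      have := card_le_card hsub
      rwa [card_image_of_injective _ (add_left_injective (u - u'))] at this
    have hinj2 : Set.InjOn (fun y => π e₀ + y) ↑(Cb - Cb) := fun y _ y' _ hy => add_left_cancel hy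
    calc (Cb - Cb).card * E.card = ∑ y ∈ Cb - Cb, E.card := by rw [sum_const, smul_eq_mul]
      _ ≤ ∑ y ∈ Cb - Cb, (S.filter (fun x => π x = π e₀ + y)).card := sum_le_sum hcl
      _ = ∑ z ∈ (Cb - Cb).image (fun y => π e₀ + y), (S.filter (fun x => π x = z)).card := by
          rw [sum_image (fun y hy y' hy' hyy => hinj2 hy hy' hyy)]
      _ ≤ ∑ z ∈ S.image π, (S.filter (fun x => π x = z)).card := by
          apply sum_le_sum_of_subset_of_nonneg
          · intro z hz
            obtain ⟨y, hy, rfl⟩ := mem_image.1 hz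
            obtain ⟨cu, hcu, cu', hcu', rfl⟩ := mem_sub.1 hy
            obtain ⟨u, hu, rfl⟩ := mem_image.1 hcu
            obtain ⟨u', hu', rfl⟩ := mem_image.1 hcu'
            exact mem_image.2 ⟨e₀ + (u - u'), add_mem_add he₀ (sub_mem_sub hu hu'), by rw [map_add, map_sub]⟩
          · intros; exact Nat.zero_le _
      _ = S.card := hdecomp.symm
  have hEcard : E.card = (A l).card * (B l).card := STPPPackingSumset.card_sub_eq h l (hC l)
  rw [hEcard] at hfib
  have := Nat.mul_le_mul_left ((A l).card * (B l).card) hkn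
  rw [← hKdef, ← hQdef] at *
  calc (A l).card * (B l).card * knLB (Fintype.card G / K.card) (C l).card + ∑ t ∈ univ.erase l, (A t).card * (B t).card
      ≤ (Cb - Cb).card * ((A l).card * (B l).card) + ∑ t ∈ univ.erase l, (A t).card * (B t).card := by
        rw [mul_comm ((Cb - Cb).card)]; exact Nat.add_le_add_right this _
    _ ≤ S.card + ∑ t ∈ univ.erase l, (A t).card * (B t).card := Nat.add_le_add_right hfib _
    _ ≤ Fintype.card G := by rw [add_comm]; exact hroom

/-! ## The kill schema E3KJ: E3K with joint (room-capped) class sizes -/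

/-- **Rule E3KJ, pair `(A,B)`.**  As `false_of_energy3k`, but the class sizes may use the JOINT structure of the member: the letter
class size `n_X` need only be admissible for the divisors `d` of `M` that pass the ROOM CAP of J1 (`d·|Y_t||Z_t| + S_X ≤ M`), and the
pair-class size `q` need only satisfy `q + d ≤ 2md` for the pairs `(d, m)` with `a_t b_t ≤ md` for which the one-coset case `m = 1`
passes the QUOTIENT ROOM test of J2 (`a_t b_t · knLB (M/d) c_t + S_C ≤ M`).  If the E3K inequality fails with such sizes, the family
does not exist.  (Floors and double counting exactly as in `three_room_energy_diffAB`.) [original] -/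
theorem false_of_energy3kj (h : IsSTPP A B C) {a b c : Fin N → ℕ} (ha : ∀ r, (A r).card = a r)
    (hb : ∀ r, (B r).card = b r) (hc : ∀ r, (C r).card = c r) (hpos : ∀ r, 0 < a r ∧ 0 < b r ∧ 0 < c r)
    {M : ℕ} (hM : Fintype.card G = M) (t : Fin N) (SA SB SC : ℕ)
    (hSA : SA = ∑ u ∈ univ.erase t, b u * c u) (hSB : SB = ∑ u ∈ univ.erase t, c u * a u)
    (hSC : SC = ∑ u ∈ univ.erase t, a u * b u) (nA nB nC q : ℕ)
    (hnA : ∀ d ∈ M.divisors, d * (b t * c t) + SA ≤ M → nA + 1 + d ≤ 2 * (d * ((a t + d - 1) / d)))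
    (hnB : ∀ d ∈ M.divisors, d * (c t * a t) + SB ≤ M → nB + 1 + d ≤ 2 * (d * ((b t + d - 1) / d)))
    (hnC : ∀ d ∈ M.divisors, d * (a t * b t) + SC ≤ M → nC + 1 + d ≤ 2 * (d * ((c t + d - 1) / d)))
    (hq : ∀ d ∈ M.divisors, ∀ m : ℕ, a t * b t ≤ m * d →
      (m = 1 → a t * b t * knLB (M / d) (c t) + SC ≤ M) → q + d ≤ 2 * (m * d))
    (hbig : M < 2 * (a t * b t * c t))
    (hkill : (a t * b t * c t) ^ 2 <
      M * (a t * b t * c t - ((M - (a t * b t * c t + SA)) + (M - (a t * b t * c t + SB)) +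
        (M - (a t * b t * c t + SC)))) +
      (a t * b t * c t - (a t * b t * c t - ((M - (a t * b t * c t + SA)) + (M - (a t * b t * c t + SB)) +
        (M - (a t * b t * c t + SC))))) +
      nA * ((a t * b t * c t - (M - (a t * b t * c t + SA))) - (a t * b t * c t -
        ((M - (a t * b t * c t + SA)) + (M - (a t * b t * c t + SB)) + (M - (a t * b t * c t + SC))))) +
      nB * ((a t * b t * c t - (M - (a t * b t * c t + SB))) - (a t * b t * c t -
        ((M - (a t * b t * c t + SA)) + (M - (a t * b t * c t + SB)) + (M - (a t * b t * c t + SC))))) +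
      nC * ((a t * b t * c t - (M - (a t * b t * c t + SC))) - (a t * b t * c t -
        ((M - (a t * b t * c t + SA)) + (M - (a t * b t * c t + SB)) + (M - (a t * b t * c t + SC))))) +
      (q - 1 - nA - nB) * ((a t * b t * c t - ((M - (a t * b t * c t + SA)) + (M - (a t * b t * c t + SB)))) -
        (a t * b t * c t - ((M - (a t * b t * c t + SA)) + (M - (a t * b t * c t + SB)) +
          (M - (a t * b t * c t + SC)))))) :
    False := by
  classical
  have hA : ∀ u, (A u).Nonempty := fun u => card_pos.1 (by rw [ha u]; exact (hpos u).1)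
  have hB : ∀ u, (B u).Nonempty := fun u => card_pos.1 (by rw [hb u]; exact (hpos u).2.1)
  have hC : ∀ u, (C u).Nonempty := fun u => card_pos.1 (by rw [hc u]; exact (hpos u).2.2)
  have hMpos : M ≠ 0 := by rw [← hM]; exact Fintype.card_ne_zero
  have eA : ∑ u ∈ univ.erase t, (B u).card * (C u).card = SA := by
    rw [hSA]; exact sum_congr rfl fun u _ => by rw [hb u, hc u]
  have eB : ∑ u ∈ univ.erase t, (C u).card * (A u).card = SB := by
    rw [hSB]; exact sum_congr rfl fun u _ => by rw [hc u, ha u]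
  have eC : ∑ u ∈ univ.erase t, (A u).card * (B u).card = SC := by
    rw [hSC]; exact sum_congr rfl fun u _ => by rw [ha u, hb u]
  -- J1: Kneser with the period's room cap, three letters
  have kA : nA + 1 ≤ (A t - A t).card := by
    obtain ⟨hd, -, hineq⟩ := kneser_sub_self_addStab (A t) (hA t)
    have hdm : (A t - A t).addStab.card ∈ M.divisors := Nat.mem_divisors.2 ⟨by rw [← hM]; exact hd, hMpos⟩
    have hroom := card_addStab_letterA_le h hA t
    rw [eA, hb t, hc t, hM] at hroom
    have := hnA _ hdm hroom
    rw [ha t] at hineq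
    omega
  have kB : nB + 1 ≤ (B t - B t).card := by
    obtain ⟨hd, -, hineq⟩ := kneser_sub_self_addStab (B t) (hB t)
    have hdm : (B t - B t).addStab.card ∈ M.divisors := Nat.mem_divisors.2 ⟨by rw [← hM]; exact hd, hMpos⟩
    have hroom := card_addStab_letterB_le h hB t
    rw [eB, hc t, ha t, hM] at hroom
    have := hnB _ hdm hroom
    rw [hb t] at hineq
    omega
  have kC : nC + 1 ≤ (C t - C t).card := by
    obtain ⟨hd, -, hineq⟩ := kneser_sub_self_addStab (C t) (hC t)
    have hdm : (C t - C t).addStab.card ∈ M.divisors := Nat.mem_divisors.2 ⟨by rw [← hM]; exact hd, hMpos⟩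
    have hroom := card_addStab_letterC_le h hC t
    rw [eC, ha t, hb t, hM] at hroom
    have := hnC _ hdm hroom
    rw [hc t] at hineq
    omega
  -- J2: Kneser for the pair class with the one-coset room test
  have kQ : q ≤ ((A t - B t) - (A t - B t)).card := by
    have hE : (A t - B t).Nonempty := (hA t).sub (hB t)
    obtain ⟨hkn, hdvdEK, hdvdG, hdpos⟩ := kneser_pairClass (A t - B t) hE
    set K := ((A t - B t) - (A t - B t)).addStab with hK
    have hdm : K.card ∈ M.divisors := Nat.mem_divisors.2 ⟨by rw [← hM]; exact hdvdG, hMpos⟩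
    obtain ⟨m, hm⟩ := hdvdEK
    have hEcard : (A t - B t).card = a t * b t := by rw [STPPPackingSumset.card_sub_eq h t (hC t), ha t, hb t]
    have hEle : a t * b t ≤ m * K.card := by
      rw [← hEcard, mul_comm, ← hm]
      exact card_le_card (subset_add_left _ (((hA t).sub (hB t)).sub ((hA t).sub (hB t))).zero_mem_addStab)
    have h1 : m = 1 → a t * b t * knLB (M / K.card) (c t) + SC ≤ M := by
      intro hm1
      rw [hm1, mul_one] at hm
      have := pairClass_one_coset_room h hA hB hC t hm
      rw [← hK, eC, ha t, hb t, hc t, hM] at this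
      exact this
    have := hq K.card hdm m hEle h1
    rw [hm] at hkn
    have : 2 * (m * K.card) = 2 * (K.card * m) := by ring
    omega
  have := three_room_energy_diffAB h hA hB hC t (M - (a t * b t * c t + SA)) (M - (a t * b t * c t + SB))
    (M - (a t * b t * c t + SC)) (by rw [eA, ha t, hb t, hc t, hM]; omega)
    (by rw [eB, ha t, hb t, hc t, hM]; omega) (by rw [eC, ha t, hb t, hc t, hM]; omega)
    (by rw [ha t, hb t, hc t, hM]; exact hbig) nA nB nC q kA kB kC kQ
  rw [ha t, hb t, hc t, hM] at this
  exact absurd this (not_le.2 hkill)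

end STPPThreeRoomEnergy

end Summit.MatrixMultiplication.MatrixMultiplication.Theorems
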